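import Literature.AlgebraicGeometry.AbelianSchemes.AbelianSchemeQuotientDualSideAction
import Literature.AlgebraicGeometry.AbelianSchemes.AbelianSchemeTheoremOfSquareOfDualPair
import Literature.AlgebraicGeometry.AbelianSchemes.RigidifyAlongUnitSlice
import Literature.AlgebraicGeometry.AbelianSchemes.FibrewisePicZeroDescendsAlongSurjection
import Literature.AlgebraicGeometry.RelativeSpec.EquivariantModuleRankDescent
import Literature.AlgebraicGeometry.Modules.EquivariantStructure
import Literature.AlgebraicGeometry.AbelianSchemes.AbelianSchemeKOfLLocal
import Literature.AlgebraicGeometry.AbelianSchemes.RigidifiedLineBundleTensor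
import HarnessLib

/-!
# Mumford's construction over a base: the descent `𝒫` of `Λ(L)` along `1 × π : A ×_S A → A ×_S (A⁄K)` — rank one,
# rigidified, fibrewise in `Pic⁰`, with `(1 × π)^*𝒫 ≅ Λ(L)`

Layer `Literature/AlgebraicGeometry/AbelianSchemes`, namespace `Literature.AlgebraicGeometry.AbelianSchemes.AbelianSchemeOver`.
THEOREMS ONLY (no definition, no named fact, no instance, no notation, no `sorry`; net Literature debt 0).

Source: [MumfordAV1970] §13, Theorem p. 125 and its proof («`X̂ = X⁄K(L)`; the Poincaré bundle `P` on `X × X̂` is the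
descent of `Λ(L) = m^*L ⊗ p₁^*L⁻¹ ⊗ p₂^*L⁻¹` along `1 × π`, for the action of `K(L)` on the second factor lifted to `Λ(L)`;
`P|_{X × {π x}} ≅ T_x^*L ⊗ L⁻¹ ∈ Pic⁰`, `P|_{{0} × X̂}` trivial»); §12 Thm. 1 (p. 112) (descent of sheaves along a free
finite quotient); [MumfordFogartyKirwan1994] Ch. 6 §2 (p. 121) (normalisation along `ε × 1_{X̂}`); [MilneAV2008] I §8
(pp. 36–37).  THIS FILE runs the construction RELATIVE to a base `S → Y` (`Y` affine) for an abelian scheme `A → S`, a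
rank-one `L` rigidified along the unit section, and a finite group `K ≤ A(S)` of SECTIONS lying in `K(L)` (the CONSTANT part
of `K(L)`; the full étale `K(L)` is constant étale-locally on the base) — i.e. step (M-b) of the tree's road to the dual
abelian scheme — entirely over ★ capital:

* the quotient `A⁄K` = ★ `AbelianSchemeConstSubgroupQuotient.quotientBy u K hcov hG hsm hgc` (its four raw hypotheses are
  binders here, ★-discharged elsewhere) with `π = quotientMk`; the action `ρ = 1 × t_•` of `K` on `A ×_S A` over
  `1 × π` = ★ `AbelianSchemeQuotientDualSideAction.prodTranslationActionOver A A u K hcov` (a free affine geometric quotient,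
  ★ `isGeometricQuotient_prodTranslationActionOver`, `prodTranslationActionOver_free`);
* a `K`-LINEARISATION `Φ` of `Λ(L)` (★ `mumfordBundle`) for `ρ` is a BINDER of this file (it exists as soon as every
  `σ ∈ K` stabilises `Λ(L)` — `MumfordBundleTranslationStabilizer` — by rigid descent along `{0} × A`,
  `MumfordBundleEquivariantStructure`; any linearisation will do here);
* §1 `exists_rigidifiedLineBundle_mumfordBundle_fibrewisePicZero` — `Λ(L)` ITSELF is a rigidified fibrewise-`Pic⁰` family on
  `A_A` over the second factor (★ `nonempty_pullback_unitSlice_mumfordBundle_iso`, ★ `fibrewisePicZero_mumfordFamily` for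
  `(1_A × 1_A)^*Λ(L) ≅ Λ(L)`, `nonempty_mumfordBundle_iso_pullback_baseChangeToProd_self`);
* §2 **`exists_rigidified_descent_mumfordBundle_of_quotient`** — for ANY abelian scheme `B`, `q : A → B` surjective locally of
  finite type and an action `ρ′` making `1 × q` a free affine geometric quotient, with a linearisation `Φ′` of `Λ(L)`: a module
  `𝒫` on `A ×_S B` (namely ★ `rigidify B F` for the ★ (β)/(T1) descent `F` of `Λ(L)`) with (F1) `HasRank 𝒫 1`, (F2)
  `(ε_A × 1)^*𝒫 ≅ 𝒪` (★ `nonempty_pullback_unitSlice_rigidify_iso`), (F3) every geometric slice `𝒫|_{A_s × {b}}` translation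
  invariant (★ `RigidifiedLineBundle.forall_isHomogeneous_fibreSlice_of_rigidified_of_surjective` along `q`, fed with §1, and ★
  `isHomogeneous_fibreSlice_rigidify_iff`), and (F4) THE SOCKET `(1 × q)^*𝒫 ≅ Λ(L)` (★ `nonempty_pullback_whiskerLeft_rigidify_iso`)
  — the three non-universal fields of ★ `AbelianSchemeOver.DualPair` at `hat := B` plus the isomorphism from which universality
  is proved downstream;
* §3 **`exists_rigidified_descent_mumfordBundle`** — THE (M-b) PACKAGE: §2 at `B := A⁄K`, `q := π` (finite surjective, ★
  `quotientMk_left_surjective`, `isFinite_quotientMk_left`), `ρ′ := 1 × t_•`.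

Cell `hodgecm-mathlib` (D-0151), FLOOR 0 programme P1, sub-line `Cruxes/HDel/Lines/F3DualAbelianScheme` (author of record
B-plan1 (g19)), stub (M) `stub_F3M`, inner step (M-b) ((M) cut v0 5c279ade; census
`B-provers/B-p16/g18/CENSUS-F3Mb-ConstantKQuotientPoincare.B-p16g18.md`, road R «rigidify»).  No reducedness, no theorem of
the square over the base, no dual pair is used.  Count-neutral; HC_CM is proved only modulo the 7 printed citations until
rung 0 closes; nothing here is about HC.

Mathlib searched (pin): `Scheme.Modules.pullbackId`, `pullbackCongr`, `IsFinite`, `Surjective`; Mathlib has no abelian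
schemes, no Mumford bundle and no descent along finite quotients.

## References
* [MumfordAV1970] D. Mumford, *Abelian Varieties* (1970), §8 ((iv) ⇔ (i)), §12 Thm. 1 (p. 112), §13 (Thm. p. 125 and proof).
* [MumfordFogartyKirwan1994] D. Mumford, J. Fogarty, F. Kirwan, *GIT* 3rd ed. (1994), Ch. 6 §1 Cor. 6.8 (p. 118), §2 (p. 121).
* [MilneAV2008] J. S. Milne, *Abelian Varieties* (v2.00, 2008), I §8 pp. 36–37 and p. 40.
-/

set_option autoImplicit false

noncomputable section

-- `Scheme.Modules` / `SheafOfModules` are not reducible; `(A.X ⊗ B.X).left = A.prodLeft B = (A.baseChange B.X.hom).X.left`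
-- and `(A.quotientBy …).X = A.quotientOver …` hold by `rfl` only.
set_option backward.isDefEq.respectTransparency false

universe u

open CategoryTheory CategoryTheory.Limits AlgebraicGeometry MonoidalCategory
open scoped MonObj

namespace Literature.AlgebraicGeometry.AbelianSchemes

open Literature.AlgebraicGeometry.RelativeSpec Literature.AlgebraicGeometry.Modules
  Literature.AlgebraicGeometry.Motives Literature.AlgebraicGeometry.AbelianVarieties

/-! ### §0 Junction: (β)/(T1) fed with a bundled equivariant structure, for a VARIABLE action -/

section Aux

variable {X Q : Scheme.{u}} {r : X ⟶ Q} {G : Type u} [Group G] [Fintype G] [IsAffineHom r] (τ : ActionOver r G)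
  (hτ : τ.IsGeometricQuotient r)
  (hfr : ∀ (V : Q.Opens), IsAffineOpen V → ∀ g : G, g ≠ 1 →
    Ideal.span (Set.range fun b : Γ(X, r ⁻¹ᵁ V) ↦ τ.act g V b - b) = ⊤)
  (E : X.Modules)

include hτ hfr in
/-- (β)/(T1) for a bundled equivariant structure and a VARIABLE action `τ` (so that the instantiation at the concrete action
`1 × t_•` below is a syntactic match, no unfolding of its automorphisms): a rank-`n` module with a `G`-linearisation on the
total space of a free affine geometric quotient `r : X → Q` is `r^* F` for a quasi-coherent `F` of rank `n` (★
`ActionOver.exists_descent_of_free_of_hasRank`). [cite: MumfordAV1970, §12 Thm. 1 (p. 112)] -/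
private theorem exists_descent_of_equivariantStructure' (Ψ : τ.EquivariantStructure E) {n : ℕ} (hE : HasRank E n) :
    ∃ (F : Q.Modules) (_ : F.IsQuasicoherent) (_ : HasRank F n), Nonempty ((Scheme.Modules.pullback r).obj F ≅ E) := by
  obtain ⟨F, hF, hF1, e, -⟩ := τ.exists_descent_of_free_of_hasRank E Ψ.iso hτ hfr Ψ.iso_one_hom Ψ.iso_mul_hom hE
  exact ⟨F, hF, hF1, ⟨e⟩⟩

end Aux

namespace AbelianSchemeOver

variable {S : Scheme.{u}} (A : AbelianSchemeOver S) {Y : Scheme.{u}} (u : S ⟶ Y) (K : Subgroup A.Sections)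
  [Finite K] [Y.IsSeparated] [IsSeparated (A.X.hom ≫ u)] [S.IsSeparated]
  (hcov : ∀ x : A.left, ∃ O : (A.translationActionOver u K).StableAffineOpens, x ∈ O.1)
  [LocallyOfFiniteType (A.X.hom ≫ u)] [IsLocallyNoetherian Y]
  (hG : ∃ _ : GrpObj (A.quotientOver u K), IsMonHom (A.quotientMk u K hcov))
  (hsm : Smooth (A.quotientOver u K).hom) (hgc : GeometricallyConnected (A.quotientOver u K).hom)
  [IsAffine Y]
  (hfree : ∀ (Ω : Type u) [Field Ω] [IsAlgClosed Ω] (x : Spec (.of Ω) ⟶ A.left) (σ : K), σ ≠ 1 →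
    x ≫ (A.translation (σ : A.Sections)).left ≠ x)
  {L : A.left.Modules} (hL : HasRank L 1)
  (hε : CechPic.pullback A.unitSection (detClass (HasRank.isFiniteLocallyFree' hL)) = 1)
  (Φ : (prodTranslationActionOver A A u K hcov).EquivariantStructure (A.mumfordBundle L))

/-! ## §1 `Λ(L)` as a rigidified fibrewise-`Pic⁰` family over the second factor -/

omit [S.IsSeparated] in
/-- **The universal Mumford family `(1_A × 1_A)^*Λ(L)` on `A_A` is `Λ(L)`** up to the canonical isomorphism
(`1_A × 1_A = 𝟙`, ★ `baseChangeToProd_self_id`, and `𝟙^* ≅ id`). [cite: MumfordFogartyKirwan1994, Ch. 6 §2 Definition 6.2 (p. 120)] -/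
theorem nonempty_mumfordBundle_iso_pullback_baseChangeToProd_self :
    Nonempty (A.mumfordBundle L ≅
      (Scheme.Modules.pullback (A.baseChangeToProd A A.X.hom (𝟙 _) (Category.id_comp _))).obj (A.mumfordBundle L)) := by
  have h : 𝟙 (A.prodLeft A) = A.baseChangeToProd A A.X.hom (𝟙 _) (Category.id_comp _) := A.baseChangeToProd_self_id.symm
  let Λ' : (A.prodLeft A).Modules := A.mumfordBundle L
  exact ⟨((Scheme.Modules.pullbackId (A.prodLeft A)).app Λ').symm ≪≫ (Scheme.Modules.pullbackCongr h).app Λ'⟩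

omit [S.IsSeparated] in
include hL hε in
/-- **`Λ(L)` itself, as a rigidified line bundle on `A_A = A ×_S A` over the SECOND factor, lies fibrewise in `Pic⁰`**:
it is rigidified along the unit section `(ε, id)` of `A_A` (★ `nonempty_pullback_unitSlice_mumfordBundle_iso`, ★
`unitSection_baseChange_eq_unitSlice`) and isomorphic to the universal Mumford family `(1_A × 1_A)^*Λ(L)` (★
`fibrewisePicZero_mumfordFamily`, transport ★ `FibrewisePicZero.of_iso`). [cite: MumfordAV1970, §8 (pp. 74–75) and §13 (p. 125)]
[cite: MilneAV2008, I §8 pp. 36–37] -/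
theorem exists_rigidifiedLineBundle_mumfordBundle_fibrewisePicZero :
    ∃ 𝒬 : A.RigidifiedLineBundle A.X.hom, 𝒬.L = A.mumfordBundle L ∧ 𝒬.FibrewisePicZero := by
  have r : Nonempty ((Scheme.Modules.pullback (A.baseChange A.X.hom).unitSection).obj (A.mumfordBundle L) ≅
      SheafOfModules.unit _) := by
    rw [unitSection_baseChange_eq_unitSlice A A]
    exact A.nonempty_pullback_unitSlice_mumfordBundle_iso hL hε
  obtain ⟨j⟩ := A.nonempty_mumfordBundle_iso_pullback_baseChangeToProd_self (L := L)
  exact ⟨⟨A.mumfordBundle L, A.hasRank_mumfordBundle hL, r⟩, rfl,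
    RigidifiedLineBundle.FibrewisePicZero.of_iso
      (ℒ := ⟨_, A.hasRank_mumfordFamily hL A.X.hom (𝟙 _) (Category.id_comp _),
        A.rigid_mumfordFamily hL hε A.X.hom (𝟙 _) (Category.id_comp _)⟩)
      (ℳ := ⟨A.mumfordBundle L, A.hasRank_mumfordBundle hL, r⟩) j.symm
      (A.fibrewisePicZero_mumfordFamily hL hε A.X.hom (𝟙 _) (Category.id_comp _))⟩

/-! ## §2 Descent of `Λ(L)` along `1 × q` for ANY free finite quotient presentation `q : A → B`, then rigidify -/

omit [S.IsSeparated] in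
include hL hε in
/-- **Mumford's construction for an ARBITRARY free finite quotient presentation of the second factor.**  Let `B` be an abelian
scheme over `S`, `q : A → B` an `S`-morphism, surjective and locally of finite type, `ρ′` an action of a finite group `G` on
`A ×_S A` for which `1 × q : A ×_S A → A ×_S B` is an AFFINE GEOMETRIC QUOTIENT, FREE on the affine charts, and `Φ′` a
`G`-linearisation of `Λ(L)` (`L` of rank one, rigidified along the unit section).  Then there is a module `𝒫` on `A ×_S B` with
(F1) `HasRank 𝒫 1`, (F2) `(ε_A × 1_B)^*𝒫 ≅ 𝒪_B`, (F3) every geometric slice `𝒫|_{A_s × {b}}` translation invariant, (F4)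
`(1 × q)^*𝒫 ≅ Λ(L)`: descend `Λ(L)` by ★ (β)/(T1) to a rank-one `F` ([MumfordAV1970] §12 Thm. 1), put `𝒫 := ` ★ `rigidify B F`
([MumfordFogartyKirwan1994] p. 121 «normalized so that the sheaf induced via `ε × 1` is `𝒪`»; ★ `hasRank_rigidify`,
`nonempty_pullback_unitSlice_rigidify_iso`), read (F3) through the surjection `q` from `Λ(L)` (§1, ★
`RigidifiedLineBundle.forall_isHomogeneous_fibreSlice_of_rigidified_of_surjective`, ★ `isHomogeneous_fibreSlice_rigidify_iff`) and
(F4) from ★ `nonempty_pullback_whiskerLeft_rigidify_iso`. [cite: MumfordAV1970, §13 Theorem (p. 125) and its proof]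
[cite: MumfordAV1970, §12 Thm. 1 (p. 112)] [cite: MumfordFogartyKirwan1994, Ch. 6 §2 (p. 121)] -/
theorem exists_rigidified_descent_mumfordBundle_of_quotient (B : AbelianSchemeOver S) (q : A.X ⟶ B.X)
    [Surjective q.left] [LocallyOfFiniteType q.left] {G : Type u} [Group G] [Fintype G]
    (ρ' : ActionOver (A.X ◁ q).left G) (hq : ρ'.IsGeometricQuotient (A.X ◁ q).left) [IsAffineHom (A.X ◁ q).left]
    (hfr : ∀ (V : ((A.X ⊗ B.X).left).Opens), IsAffineOpen V → ∀ g : G, g ≠ 1 →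
      Ideal.span (Set.range fun b : Γ((A.X ⊗ A.X).left, (A.X ◁ q).left ⁻¹ᵁ V) ↦ ρ'.act g V b - b) = ⊤)
    (Φ' : ρ'.EquivariantStructure (A.mumfordBundle L)) :
    ∃ P : (A.prodLeft B).Modules, HasRank P 1 ∧
      Nonempty ((Scheme.Modules.pullback (A.unitSlice B)).obj P ≅ SheafOfModules.unit _) ∧
      (∀ (Ω : Type u) [Field Ω] [IsAlgClosed Ω] (b : Spec (.of Ω) ⟶ B.X.left),
        IsHomogeneous (A.fibre (b ≫ B.X.hom)).toAbelianVariety ((Scheme.Modules.pullback (A.fibreSlice B b)).obj P)) ∧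
      Nonempty ((Scheme.Modules.pullback (A.X ◁ q).left).obj P ≅ A.mumfordBundle L) := by
  obtain ⟨F, _, hF, ⟨e⟩⟩ :=
    exists_descent_of_equivariantStructure' ρ' hq hfr (A.mumfordBundle L) Φ' (A.hasRank_mumfordBundle hL)
  obtain ⟨𝒬, h𝒬L, h𝒬⟩ := A.exists_rigidifiedLineBundle_mumfordBundle_fibrewisePicZero hL hε
  have e𝒬 : Nonempty ((Scheme.Modules.pullback (A.X ◁ q).left).obj F ≅ 𝒬.L) := ⟨e ≪≫ eqToIso h𝒬L.symm⟩
  refine ⟨A.rigidify B F, hasRank_rigidify hF, nonempty_pullback_unitSlice_rigidify_iso hF, fun Ω _ _ b => ?_, ?_⟩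
  · rw [isHomogeneous_fibreSlice_rigidify_iff hF]
    exact RigidifiedLineBundle.forall_isHomogeneous_fibreSlice_of_rigidified_of_surjective A 𝒬 B q F h𝒬 e𝒬 Ω b
  · obtain ⟨i⟩ := nonempty_pullback_whiskerLeft_rigidify_iso (B := B) hF q 𝒬 e𝒬
    exact ⟨i ≪≫ eqToIso h𝒬L⟩

/-! ## §3 The (M-b) package at `B := A⁄K`, `q := π`, `ρ′ := 1 × t_•` -/

include hfree hL hε Φ in
/-- **MUMFORD'S CONSTRUCTION `(A⁄K, 𝒫)` OVER A BASE — the three non-universal fields of a dual pair and the socket.**  For an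
abelian scheme `A → S → Y` (`Y` affine, `S` separated), a rank-one `L` on `A` rigidified along the unit section, a finite group
`K ≤ A(S)` of sections acting freely on geometric points, and a `K`-linearisation `Φ` of Mumford's bundle `Λ(L)` for the action
`1 × t_•` on `A ×_S A` (it exists when `K ⊆ K(L)(S)`), there is a module `𝒫` on `A ×_S (A⁄K)` such that:
(F1) `𝒫` is a line bundle; (F2) `(ε_A × 1)^*𝒫 ≅ 𝒪_{A⁄K}`; (F3) for every geometric point `b` of `A⁄K` over `s`, the slice
`𝒫|_{A_s × {b}}` is translation invariant (`∈ Pic⁰(A_s)`: `b` lifts along the finite surjective `π` to `x ∈ A_s`, and the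
slice is `Λ(L)|_{A_s × {x}} ≅ T_x^*L_s ⊗ L_s⁻¹`); (F4) THE SOCKET `(1 × π)^*𝒫 ≅ Λ(L)` — §2 at the free affine geometric quotient
`1 × π` (★ `isGeometricQuotient_prodTranslationActionOver`, ★ `prodTranslationActionOver_free`, ★
`isAffineHom_whiskerLeft_quotientMk_left`) along the finite surjective `π` (★ `quotientMk_left_surjective`, ★
`isFinite_quotientMk_left`). [cite: MumfordAV1970, §13 Theorem (p. 125) and its proof]
[cite: MumfordFogartyKirwan1994, Ch. 6 §1 Cor. 6.8 (p. 118) and §2 (p. 121)] [cite: MilneAV2008, I §8 pp. 36–37] -/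
theorem exists_rigidified_descent_mumfordBundle :
    ∃ P : (A.prodLeft (A.quotientBy u K hcov hG hsm hgc)).Modules, HasRank P 1 ∧
      Nonempty ((Scheme.Modules.pullback (A.unitSlice (A.quotientBy u K hcov hG hsm hgc))).obj P ≅
        SheafOfModules.unit _) ∧
      (∀ (Ω : Type u) [Field Ω] [IsAlgClosed Ω] (b : Spec (.of Ω) ⟶ (A.quotientBy u K hcov hG hsm hgc).X.left),
        IsHomogeneous (A.fibre (b ≫ (A.quotientBy u K hcov hG hsm hgc).X.hom)).toAbelianVariety
          ((Scheme.Modules.pullback (A.fibreSlice (A.quotientBy u K hcov hG hsm hgc) b)).obj P)) ∧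
      Nonempty ((Scheme.Modules.pullback
        (A.X ◁ (show A.X ⟶ (A.quotientBy u K hcov hG hsm hgc).X from A.quotientMk u K hcov)).left).obj P ≅
          A.mumfordBundle L) := by
  haveI : Fintype K := Fintype.ofFinite K
  -- `π` and `1 × t_•` in the `quotientBy`-typed spelling (`(quotientBy …).X = quotientOver …` is `rfl` but not reducible)
  haveI : Surjective (show A.X ⟶ (A.quotientBy u K hcov hG hsm hgc).X from A.quotientMk u K hcov).left :=
    ⟨A.quotientMk_left_surjective u K hcov⟩
  haveI : IsFinite (show A.X ⟶ (A.quotientBy u K hcov hG hsm hgc).X from A.quotientMk u K hcov).left :=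
    A.isFinite_quotientMk_left u K hcov
  haveI : IsAffineHom (A.X ◁ (show A.X ⟶ (A.quotientBy u K hcov hG hsm hgc).X from A.quotientMk u K hcov)).left :=
    isAffineHom_whiskerLeft_quotientMk_left A A u K hcov
  exact A.exists_rigidified_descent_mumfordBundle_of_quotient hL hε (A.quotientBy u K hcov hG hsm hgc)
    (show A.X ⟶ (A.quotientBy u K hcov hG hsm hgc).X from A.quotientMk u K hcov)
    (show ActionOver (A.X ◁ (show A.X ⟶ (A.quotientBy u K hcov hG hsm hgc).X from A.quotientMk u K hcov)).left K from
      prodTranslationActionOver A A u K hcov)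
    (isGeometricQuotient_prodTranslationActionOver A A u K hcov hfree) (prodTranslationActionOver_free A A u K hcov hfree) Φ

end AbelianSchemeOver

end Literature.AlgebraicGeometry.AbelianSchemes

end
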